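import Literature.AlgebraicGeometry.Resolution.FormalNormalCrossingsAlgebra
import Literature.AlgebraicGeometry.Resolution.FormalNormalCrossingsLemmas
import Literature.AlgebraicGeometry.Resolution.PowerSeriesRegularLocal
import Literature.AlgebraicGeometry.Resolution.AffineBlowupAlgebra
import Mathlib.RingTheory.Idempotents
import HarnessLib

/-!
# The local model of a normal crossings divisor: branches, double locus, and the generic
# chart of the blow-up of the double locus

Topic: `Literature/AlgebraicGeometry/Resolution`. Pure algebra in a regular local ring `P` with
elements `x₁, …, x_d ∈ 𝔪_P` having linearly independent images in `𝔪/𝔪²` (part of a regular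
system of parameters; the case in point is `P = k⟦X₁, …, X_d⟧` or, equivalently, the complete
local ring `𝒪̂_{X,x}` of a regular point with its formal coordinates) around the normal
crossings equation `π = x₁ ⋯ x_r` (de Jong 1996, 2.4 and 4.25 (i): "`Z` is defined by
`t₁ ⋯ t_r = 0`"), feeding the Artin-approximation-free proof that FORMAL normal crossings are
étale-local normal crossings (`DeJong1996FormalNormalCrossings`, `AlterationsNormalFormBlowup.lean`;
files `FormalBranches*.lean`). The objects (the definitions need no hypothesis on `P`, `x`):

* `branchSet d r` — the indices `i < r` of the branches; `branchProd x r = π = ∏_{i<r} xᵢ`;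
  `branchCofactor x r j = m_j = ∏_{i<r, i≠j} xᵢ` (the equation of the union of the other
  branches); `doubleLocusIdeal x r = (m_j : j < r)` — the (reduced) ideal of the locus where
  at least two branches meet (`⋂_{i<j<r} (xᵢ, xⱼ)`; it is also the Jacobian ideal
  `(π, ∂π)` of `π`, which is how it is reached from an algebraic equation in
  `FormalBranchesJacobian.lean`);
* `BranchProduct x r = Π_{j<r} P/(xⱼ)` — the product of the branch rings, i.e. the
  normalisation of `P/(π)`.

The MAIN RESULT is the computation of ONE affine chart of the blow-up of `Spec P/(π)` along the
double locus, the chart of a GENERIC generator `s = Σ_j a_j m_j` (`a_j` units):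
**`(P/(π))[ (m_j)_j / s ] ≅ Π_{j<r} P/(xⱼ)`** as `P`-algebras (`branchModelEquiv`; the affine
blowup algebra `blowupAlgebra` of `AffineBlowupAlgebra.lean`). Indeed `g_j = a_j m_j / s` are
complete orthogonal idempotents of `(P/(π))[1/s]` killed by `xⱼ` (`cofactorIdem`), so
`c ↦ Σ_j c_j g_j` is an injective `P`-algebra map `Π_j P/(xⱼ) → (P/(π))[1/s]`
(`branchModelHom`, `branchModelHom_injective`) whose image is the blowup algebra
(`range_branchModelHom`). In words: because `s` involves every `m_j` with a unit coefficient,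
the single chart `D₊(s)` of the blow-up already contains all `r` branches, and separates them.
This is what makes the étale-local splitting of the branches of an algebraic divisor with
normal crossings formal structure possible without Artin approximation: the chart is defined
by polynomial data (an ideal and one of its elements) which can be read off on the variety,
and blowup algebras commute with flat base change (the completion).

Also: `mk_cofactorSum_mem_nonZeroDivisors` (`s` is a non-zero-divisor modulo `π`),
`span_branchProd_eq_iInf` (`(π) = ⋂_{j<r} (xⱼ)`), `mem_span_X_of_branchCofactor_mul_mem`
(`m_j` is a non-zero-divisor modulo `xⱼ`), `isLocalRing_quotient_span_of_mem_maximalIdeal`,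
and the power series instance `linearIndependent_toCotangent_X` (the variables of
`k⟦X₁, …, X_d⟧` qualify).

## Sources

* A. J. de Jong, *Smoothness, semi-stability and alterations*, Publ. Math. IHÉS 83 (1996),
  2.4 (p. 55), 4.25 (i) (p. 75). [DeJong1996]
* The Stacks Project, Tag 052Q (affine blowup algebras), Tag 0BI9 (normal crossings).
  [StacksProject]
* U. Görtz, T. Wedhorn, *Algebraic Geometry I*, 2nd ed. (2020), (13.19) (the charts `A[I/f]`).
  [GortzWedhorn2020]

All statements are [folklore] computations; no named facts.
-/

noncomputable section

open IsLocalRing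

namespace Literature.AlgebraicGeometry.Resolution

universe u

variable {d : ℕ} {P : Type u} [CommRing P] (x : Fin d → P) (r : ℕ)

/-! ## The objects -/

variable (d) in
/-- The indices `i < r` of the branches of `x₁ ⋯ x_r`. [folklore] -/
def branchSet : Finset (Fin d) := Finset.univ.filter fun i : Fin d => (i : ℕ) < r

/-- The normal crossings equation `π = x₁ ⋯ x_r` of the first `r` members of a family
`x : Fin d → P` (for `P = k⟦X₁, …, X_d⟧` and `x = X` this is
`DeJong1996.normalCrossingsEquation k d r` of `AlterationsNormalForm.lean`).
[cite: DeJong1996, 4.25 (i), p. 75] -/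
def branchProd : P := ∏ i ∈ branchSet d r, x i

/-- The cofactor `m_j = ∏_{i<r, i≠j} xᵢ` of the branch `xⱼ`: the equation of the union of
the other branches. [folklore] -/
def branchCofactor (j : Fin d) : P := ∏ i ∈ (branchSet d r).erase j, x i

/-- The ideal `(m_j : j < r)` of the double locus `⋃_{i<j<r} V(xᵢ, xⱼ)` of `V(x₁ ⋯ x_r)`.
[folklore] -/
def doubleLocusIdeal : Ideal P := Ideal.span (branchCofactor x r '' ↑(branchSet d r))

/-- The product `Π_{j<r} P/(xⱼ)` of the branch rings. [folklore] -/
abbrev BranchProduct : Type u := ∀ j : ↥(branchSet d r), P ⧸ Ideal.span {x j.1}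

variable {x r}

/-! ## Elementary identities -/

/-- Unfolding `branchSet`. [folklore] -/
theorem mem_branchSet_iff {i : Fin d} : i ∈ branchSet d r ↔ (i : ℕ) < r := by
  simp [branchSet]

/-- `xⱼ · m_j = π`. [folklore] -/
theorem X_mul_branchCofactor {j : Fin d} (hj : j ∈ branchSet d r) :
    x j * branchCofactor x r j = branchProd x r :=
  Finset.mul_prod_erase _ _ hj

/-- `xⱼ ∣ m_l` for `j ≠ l`, `j < r`. [folklore] -/
theorem X_dvd_branchCofactor {j l : Fin d} (hj : j ∈ branchSet d r) (hjl : j ≠ l) :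
    x j ∣ branchCofactor x r l :=
  Finset.dvd_prod_of_mem _ (Finset.mem_erase.mpr ⟨hjl, hj⟩)

/-- `π ∣ m_j m_l` for `j ≠ l`. [folklore] -/
theorem branchProd_dvd_branchCofactor_mul {j l : Fin d} (hl : l ∈ branchSet d r) (hjl : j ≠ l) :
    branchProd x r ∣ branchCofactor x r j * branchCofactor x r l := by
  have hlj : l ∈ (branchSet d r).erase j := Finset.mem_erase.mpr ⟨fun h => hjl h.symm, hl⟩
  have h1 : x l * ∏ i ∈ ((branchSet d r).erase j).erase l, x i =
      branchCofactor x r j := Finset.mul_prod_erase _ _ hlj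
  refine ⟨∏ i ∈ ((branchSet d r).erase j).erase l, x i, ?_⟩
  rw [← h1, ← X_mul_branchCofactor hl]
  ring

/-- `π ∈ (m_j)` for `j < r`. [folklore] -/
theorem branchProd_mem_doubleLocusIdeal {j : Fin d} (hj : j ∈ branchSet d r) :
    branchProd x r ∈ doubleLocusIdeal x r := by
  rw [← X_mul_branchCofactor hj]
  exact Ideal.mul_mem_left _ _ (Ideal.subset_span ⟨j, hj, rfl⟩)

/-- `m_j` lies in the double locus ideal. [folklore] -/
theorem branchCofactor_mem_doubleLocusIdeal {j : Fin d} (hj : j ∈ branchSet d r) :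
    branchCofactor x r j ∈ doubleLocusIdeal x r :=
  Ideal.subset_span ⟨j, hj, rfl⟩

/-- The branch rings `P/(xⱼ)` are local for `xⱼ ∈ 𝔪_P`. [folklore] -/
theorem isLocalRing_quotient_span_of_mem_maximalIdeal [IsLocalRing P] {y : P}
    (hy : y ∈ maximalIdeal P) : IsLocalRing (P ⧸ Ideal.span {y}) :=
  haveI : Nontrivial (P ⧸ Ideal.span {y}) :=
    Ideal.Quotient.nontrivial_iff.mpr (Ideal.span_singleton_ne_top hy)
  IsLocalRing.of_surjective' (Ideal.Quotient.mk _) Ideal.Quotient.mk_surjective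

/-! ## The `xᵢ` as part of a regular system of parameters: non-zero-divisor facts -/

section Regular

variable [IsRegularLocalRing P] (hx : ∀ i, x i ∈ maximalIdeal P)
  (hli : LinearIndependent (ResidueField P) fun i => (maximalIdeal P).toCotangent ⟨x i, hx i⟩)

include hli in
/-- `xᵢ` is a non-zero-divisor modulo `xⱼ` (`i ≠ j`). [folklore] -/
theorem mem_span_X_of_X_mul_mem {i j : Fin d} (hij : i ≠ j) {b : P}
    (h : x i * b ∈ Ideal.span {x j}) :
    b ∈ Ideal.span {x j} := by
  have hiT : i ∉ ({j} : Set (Fin d)) := by simpa using hij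
  have key := mem_span_image_of_mul_mem_of_linearIndependent_toCotangent x hx hli i {j} hiT b
    (by rwa [Set.image_singleton])
  rwa [Set.image_singleton] at key

include hli in
/-- A product of members of the family other than `xⱼ` is a non-zero-divisor modulo `xⱼ`.
[folklore] -/
theorem mem_span_X_of_prod_X_mul_mem {j : Fin d} (T : Finset (Fin d)) (hjT : j ∉ T)
    {b : P} (h : (∏ i ∈ T, x i) * b ∈ Ideal.span {x j}) :
    b ∈ Ideal.span {x j} := by
  classical
  induction T using Finset.induction_on generalizing b with
  | empty => simpa using h
  | insert a T ha ih =>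
    have haj : a ≠ j := fun h' => hjT (by rw [h']; exact Finset.mem_insert_self _ _)
    have hjT' : j ∉ T := fun h' => hjT (Finset.mem_insert_of_mem h')
    rw [Finset.prod_insert ha, mul_assoc] at h
    exact ih hjT' (mem_span_X_of_X_mul_mem hx hli haj h)

include hli in
/-- **`m_j` is a non-zero-divisor modulo `xⱼ`.** [folklore] -/
theorem mem_span_X_of_branchCofactor_mul_mem {j : Fin d} {b : P}
    (h : branchCofactor x r j * b ∈ Ideal.span {x j}) :
    b ∈ Ideal.span {x j} :=
  mem_span_X_of_prod_X_mul_mem hx hli ((branchSet d r).erase j) (Finset.notMem_erase j _) h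

include hli in
variable (r) in
/-- **`(π) = ⋂_{j<r} (xⱼ)`.** [folklore] -/
theorem span_branchProd_eq_iInf :
    Ideal.span {branchProd x r} = ⨅ j ∈ branchSet d r, Ideal.span {x j} :=
  span_singleton_prod_eq_iInf_of_linearIndependent_toCotangent x hx hli (branchSet d r)

include hli in
/-- Membership in `(π)`: divisible by every `xⱼ`, `j < r`. [folklore] -/
theorem mem_span_branchProd_iff {b : P} :
    b ∈ Ideal.span {branchProd x r} ↔ ∀ j ∈ branchSet d r, b ∈ Ideal.span {x j} := by
  rw [span_branchProd_eq_iInf r hx hli]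
  simp only [Submodule.mem_iInf]

include hli in
/-- `(π) ⊆ (xⱼ)` for `j < r`. [folklore] -/
theorem span_branchProd_le_span_X {j : Fin d} (hj : j ∈ branchSet d r) :
    Ideal.span {branchProd x r} ≤ Ideal.span {x j} :=
  fun _ hb => (mem_span_branchProd_iff hx hli).mp hb j hj

end Regular

/-! ## A generic generator `s = Σ a_j m_j` of the double locus ideal -/

section Generic

variable (a : Fin d → P) (ha : ∀ j ∈ branchSet d r, IsUnit (a j))

variable (x r) in
/-- `s = Σ_{j<r} a_j m_j`. [folklore] -/
def cofactorSum : P := ∑ j ∈ branchSet d r, a j * branchCofactor x r j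

/-- `s` lies in the double locus ideal. [folklore] -/
theorem cofactorSum_mem_doubleLocusIdeal : cofactorSum x r a ∈ doubleLocusIdeal x r :=
  Ideal.sum_mem _ fun _ hj => Ideal.mul_mem_left _ _ (branchCofactor_mem_doubleLocusIdeal hj)

/-- `s ≡ a_j m_j (mod xⱼ)`. [folklore] -/
theorem cofactorSum_sub_mem_span_X {j : Fin d} (hj : j ∈ branchSet d r) :
    cofactorSum x r a - a j * branchCofactor x r j ∈
      Ideal.span {x j} := by
  rw [cofactorSum, ← Finset.add_sum_erase _ _ hj, add_sub_cancel_left]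
  refine Ideal.sum_mem _ fun l hl => ?_
  obtain ⟨hlj, -⟩ := Finset.mem_erase.mp hl
  exact Ideal.mul_mem_left _ _
    (Ideal.mem_span_singleton.mpr (X_dvd_branchCofactor hj (fun h => hlj h.symm)))

include ha in
/-- `s` is a non-zero-divisor modulo each `xⱼ`, `j < r`. [folklore] -/
theorem mem_span_X_of_cofactorSum_mul_mem [IsRegularLocalRing P] (hx : ∀ i, x i ∈ maximalIdeal P)
    (hli : LinearIndependent (ResidueField P) fun i => (maximalIdeal P).toCotangent ⟨x i, hx i⟩)
    {j : Fin d} (hj : j ∈ branchSet d r) {b : P} (h : cofactorSum x r a * b ∈ Ideal.span {x j}) :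
    b ∈ Ideal.span {x j} := by
  have h1 : a j * branchCofactor x r j * b ∈
      Ideal.span {x j} := by
    have := Ideal.mul_mem_right b _ (cofactorSum_sub_mem_span_X (x := x) a hj)
    rw [sub_mul] at this
    exact (Submodule.sub_mem_iff_right _ h).mp this
  have h2 : branchCofactor x r j * (a j * b) ∈
      Ideal.span {x j} := by
    have : branchCofactor x r j * (a j * b) = a j * branchCofactor x r j * b := by ring
    rwa [this]
  have h3 := mem_span_X_of_branchCofactor_mul_mem hx hli h2
  exact (Ideal.unit_mul_mem_iff_mem _ (ha j hj)).mp h3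

include ha in
/-- **`s` is a non-zero-divisor modulo `π`.** [folklore] -/
theorem mk_cofactorSum_mem_nonZeroDivisors [IsRegularLocalRing P] (hx : ∀ i, x i ∈ maximalIdeal P)
    (hli : LinearIndependent (ResidueField P) fun i => (maximalIdeal P).toCotangent ⟨x i, hx i⟩) :
    Ideal.Quotient.mk (Ideal.span {branchProd x r}) (cofactorSum x r a) ∈
      nonZeroDivisors (P ⧸ Ideal.span {branchProd x r}) := by
  rw [mem_nonZeroDivisors_iff_right]
  intro y hy
  obtain ⟨b, rfl⟩ := Ideal.Quotient.mk_surjective y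
  rw [← map_mul, Ideal.Quotient.eq_zero_iff_mem] at hy
  rw [Ideal.Quotient.eq_zero_iff_mem, mem_span_branchProd_iff hx hli]
  intro j hj
  rw [mul_comm] at hy
  exact mem_span_X_of_cofactorSum_mul_mem a ha hx hli hj (span_branchProd_le_span_X hx hli hj hy)

end Generic

/-! ## The generic chart of the blow-up of the double locus: the idempotents -/

section Chart

variable (a : Fin d → P) (ha : ∀ j ∈ branchSet d r, IsUnit (a j))

/-- Notation: `B = P/(π)`. -/
local notation "Bq" => P ⧸ Ideal.span {branchProd x r}

/-- Notation: the class `s̄ ∈ P/(π)` of the generic generator. -/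
local notation "sbar" => Ideal.Quotient.mk (Ideal.span {branchProd x r}) (cofactorSum x r a)

variable (x r) in
/-- The idempotent `g_j = a_j m_j / s ∈ (P/(π))[1/s]` cutting out the branch `xⱼ = 0`.
[folklore] -/
def cofactorIdem (j : Fin d) : Localization.Away sbar :=
  algebraMap Bq (Localization.Away sbar)
      (Ideal.Quotient.mk _ (a j * branchCofactor x r j)) *
    IsLocalization.Away.invSelf (S := Localization.Away sbar) sbar

/-- `Σ_j g_j = 1`. [folklore] -/
theorem sum_cofactorIdem : ∑ j ∈ branchSet d r, cofactorIdem x r a j = 1 := by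
  unfold cofactorIdem
  rw [← Finset.sum_mul, ← map_sum, ← map_sum]
  change algebraMap Bq (Localization.Away sbar) sbar * _ = 1
  exact IsLocalization.Away.mul_invSelf _

/-- `g_j g_l = 0` for `j ≠ l`. [folklore] -/
theorem cofactorIdem_mul_cofactorIdem_of_ne {j l : Fin d} (hl : l ∈ branchSet d r) (hjl : j ≠ l) :
    cofactorIdem x r a j * cofactorIdem x r a l = 0 := by
  unfold cofactorIdem
  have h0 : Ideal.Quotient.mk (Ideal.span {branchProd x r})
      (a j * branchCofactor x r j * (a l * branchCofactor x r l)) = 0 := by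
    rw [Ideal.Quotient.eq_zero_iff_mem]
    have : a j * branchCofactor x r j * (a l * branchCofactor x r l) =
        a j * a l * (branchCofactor x r j * branchCofactor x r l) := by ring
    rw [this]
    exact Ideal.mul_mem_left _ _
      (Ideal.mem_span_singleton.mpr (branchProd_dvd_branchCofactor_mul hl hjl))
  rw [mul_mul_mul_comm, ← map_mul, ← map_mul, h0, map_zero, zero_mul]

/-- `g_j² = g_j`. [folklore] -/
theorem isIdempotentElem_cofactorIdem {j : Fin d} (hj : j ∈ branchSet d r) :
    IsIdempotentElem (cofactorIdem x r a j) := by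
  have h := congrArg (fun z => cofactorIdem x r a j * z) (sum_cofactorIdem (r := r) a)
  simp only [mul_one, Finset.mul_sum] at h
  rw [← Finset.add_sum_erase _ _ hj, Finset.sum_eq_zero (fun l hl => ?_), add_zero] at h
  · exact h
  · obtain ⟨hlj, hl'⟩ := Finset.mem_erase.mp hl
    exact cofactorIdem_mul_cofactorIdem_of_ne a hl' (fun h' => hlj h'.symm)

/-- `xⱼ · g_j = 0` (`xⱼ a_j m_j = a_j π`). [folklore] -/
theorem X_smul_cofactorIdem {j : Fin d} (hj : j ∈ branchSet d r) :
    algebraMap P (Localization.Away sbar) (x j) * cofactorIdem x r a j = 0 := by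
  unfold cofactorIdem
  rw [IsScalarTower.algebraMap_apply P Bq (Localization.Away sbar),
    ← mul_assoc, ← map_mul, Ideal.Quotient.algebraMap_eq, ← map_mul]
  have h0 : Ideal.Quotient.mk (Ideal.span {branchProd x r})
      (x j * (a j * branchCofactor x r j)) = 0 := by
    rw [Ideal.Quotient.eq_zero_iff_mem, mul_left_comm, X_mul_branchCofactor hj]
    exact Ideal.mul_mem_left _ _ (Ideal.mem_span_singleton_self _)
  rw [h0, map_zero, zero_mul]

/-- `p · g_j = 0` for `p ∈ (xⱼ)`. [folklore] -/
theorem smul_cofactorIdem_eq_zero_of_mem {j : Fin d} (hj : j ∈ branchSet d r)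
    {p : P}
    (hp : p ∈ Ideal.span {x j}) :
    algebraMap P (Localization.Away sbar) p * cofactorIdem x r a j = 0 := by
  obtain ⟨c, rfl⟩ := Ideal.mem_span_singleton'.mp hp
  rw [map_mul, mul_assoc, X_smul_cofactorIdem a hj, mul_zero]

/-- `s̄` generates a submonoid of non-zero-divisors, so `P/(π) → (P/(π))[1/s]` is injective.
[folklore] -/
theorem algebraMap_localizationAway_injective (ha : ∀ j ∈ branchSet d r, IsUnit (a j))
    [IsRegularLocalRing P] (hx : ∀ i, x i ∈ maximalIdeal P)
    (hli : LinearIndependent (ResidueField P) fun i => (maximalIdeal P).toCotangent ⟨x i, hx i⟩) :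
    Function.Injective (algebraMap Bq (Localization.Away sbar)) :=
  IsLocalization.injective (Localization.Away sbar)
    (Submonoid.powers_le.mpr (mk_cofactorSum_mem_nonZeroDivisors a ha hx hli))

/-! ## The `P`-algebra map `Π_j P/(xⱼ) → (P/(π))[1/s]` -/

/-- The `P`-linear map `P/(xⱼ) → (P/(π))[1/s]`, `c ↦ c · g_j`. [folklore] -/
def branchToChart {j : Fin d} (hj : j ∈ branchSet d r) :
    (P ⧸ Ideal.span {x j}) →ₗ[
      P] Localization.Away sbar :=
  Submodule.liftQ (Ideal.span {x j})
    ((LinearMap.mul P (Localization.Away sbar)).flip (cofactorIdem x r a j)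
      ∘ₗ (Algebra.linearMap P (Localization.Away sbar)))
    (by
      intro p hp
      rw [LinearMap.mem_ker, LinearMap.comp_apply, Algebra.linearMap_apply, LinearMap.flip_apply,
        LinearMap.mul_apply']
      exact smul_cofactorIdem_eq_zero_of_mem a hj hp)

/-- Unfolding `branchToChart` on a class. [folklore] -/
theorem branchToChart_mk {j : Fin d} (hj : j ∈ branchSet d r) (p : P) :
    branchToChart a hj (Ideal.Quotient.mk _ p) =
      algebraMap P (Localization.Away sbar) p * cofactorIdem x r a j :=
  rfl

/-- `c g_j · c' g_l = 0` for `j ≠ l`. [folklore] -/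
theorem branchToChart_mul_branchToChart_of_ne {j l : Fin d} (hj : j ∈ branchSet d r)
    (hl : l ∈ branchSet d r) (hjl : j ≠ l) (v : P ⧸ Ideal.span {x j})
    (w : P ⧸ Ideal.span {x l}) :
    branchToChart a hj v * branchToChart a hl w = 0 := by
  obtain ⟨p, rfl⟩ := Ideal.Quotient.mk_surjective v
  obtain ⟨q, rfl⟩ := Ideal.Quotient.mk_surjective w
  rw [branchToChart_mk, branchToChart_mk]
  calc _ = algebraMap _ (Localization.Away sbar) p * algebraMap _ (Localization.Away sbar) q *
        (cofactorIdem x r a j * cofactorIdem x r a l) := by ring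
    _ = 0 := by rw [cofactorIdem_mul_cofactorIdem_of_ne a hl hjl, mul_zero]

/-- `c g_j · c' g_j = (c c') g_j`. [folklore] -/
theorem branchToChart_mul_branchToChart_self {j : Fin d} (hj : j ∈ branchSet d r)
    (v w : P ⧸ Ideal.span {x j}) :
    branchToChart a hj v * branchToChart a hj w = branchToChart a hj (v * w) := by
  obtain ⟨p, rfl⟩ := Ideal.Quotient.mk_surjective v
  obtain ⟨q, rfl⟩ := Ideal.Quotient.mk_surjective w
  rw [← map_mul (Ideal.Quotient.mk _) p q, branchToChart_mk, branchToChart_mk, branchToChart_mk,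
    map_mul (algebraMap P (Localization.Away sbar)) p q]
  calc _ = algebraMap _ (Localization.Away sbar) p * algebraMap _ (Localization.Away sbar) q *
        (cofactorIdem x r a j * cofactorIdem x r a j) := by ring
    _ = _ := by rw [(isIdempotentElem_cofactorIdem a hj).eq]

variable (x r) in
/-- **The `P`-algebra map `Π_{j<r} P/(xⱼ) → (P/(π))[1/s]`, `c ↦ Σ_j c_j g_j`.** [folklore] -/
def branchModelHom : BranchProduct x r →ₐ[P] Localization.Away sbar where
  toFun c := ∑ j : ↥(branchSet d r), branchToChart a j.2 (c j)
  map_one' := by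
    have : ∀ j : ↥(branchSet d r), branchToChart a j.2 ((1 : BranchProduct x r) j) =
        cofactorIdem x r a j.1 := fun j => by
      change branchToChart a j.2 (Ideal.Quotient.mk _ 1) = _
      rw [branchToChart_mk, map_one, one_mul]
    simp_rw [this]
    rw [Finset.sum_coe_sort (branchSet d r) (cofactorIdem x r a)]
    exact sum_cofactorIdem a
  map_mul' c c' := by
    classical
    rw [Finset.sum_mul_sum]
    refine Finset.sum_congr rfl fun j _ => ?_
    rw [Finset.sum_eq_single j]
    · rw [Pi.mul_apply]
      exact (branchToChart_mul_branchToChart_self a j.2 (c j) (c' j)).symm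
    · intro l _ hlj
      exact branchToChart_mul_branchToChart_of_ne a j.2 l.2
        (fun h => hlj (Subtype.ext h).symm) (c j) (c' l)
    · intro h; exact absurd (Finset.mem_univ j) h
  map_zero' := by simp
  map_add' c c' := by
    simp only [Pi.add_apply, map_add, Finset.sum_add_distrib]
  commutes' p := by
    have : ∀ j : ↥(branchSet d r),
        branchToChart a j.2 ((algebraMap P (BranchProduct x r) p) j) =
          algebraMap P (Localization.Away sbar) p *
            cofactorIdem x r a j.1 := fun j => by
      rw [Pi.algebraMap_apply, Ideal.Quotient.algebraMap_eq, branchToChart_mk]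
    simp_rw [this]
    rw [← Finset.mul_sum, Finset.sum_coe_sort (branchSet d r) (cofactorIdem x r a),
      sum_cofactorIdem a, mul_one]

/-- Unfolding `branchModelHom`. [folklore] -/
theorem branchModelHom_apply (c : BranchProduct x r) :
    branchModelHom x r a c = ∑ j : ↥(branchSet d r), branchToChart a j.2 (c j) := rfl

/-- The map on the `j`-th unit vector: `e_j ↦ g_j`. [folklore] -/
theorem branchModelHom_single (j : ↥(branchSet d r))
    (v : P ⧸ Ideal.span {x j.1}) :
    branchModelHom x r a (Pi.single j v) = branchToChart a j.2 v := by
  classical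
  rw [branchModelHom_apply, Finset.sum_eq_single j]
  · rw [Pi.single_eq_same]
  · intro l _ hlj
    rw [Pi.single_eq_of_ne hlj, map_zero]
  · intro h; exact absurd (Finset.mem_univ j) h

/-- Multiplying `Σ_l c_l g_l` by `g_j` isolates the `j`-th term. [folklore] -/
theorem branchModelHom_mul_cofactorIdem (c : BranchProduct x r) (j : ↥(branchSet d r)) :
    branchModelHom x r a c * cofactorIdem x r a j.1 = branchToChart a j.2 (c j) := by
  classical
  have h1 : cofactorIdem x r a j.1 = branchToChart a j.2 1 := by
    change _ = branchToChart a j.2 (Ideal.Quotient.mk _ 1)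
    rw [branchToChart_mk, map_one, one_mul]
  rw [branchModelHom_apply, Finset.sum_mul, Finset.sum_eq_single j]
  · rw [h1, branchToChart_mul_branchToChart_self a j.2, mul_one]
  · intro l _ hlj
    rw [h1]
    exact branchToChart_mul_branchToChart_of_ne a l.2 j.2 (fun h => hlj (Subtype.ext h)) _ _
  · intro h; exact absurd (Finset.mem_univ j) h

/-- **Injectivity of `Π_j P/(xⱼ) → (P/(π))[1/s]`**: if `c g_j = 0` then `c a_j m_j ∈ (π) ⊆ (xⱼ)`,
and `a_j m_j` is a non-zero-divisor modulo `xⱼ`. [folklore] -/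
theorem branchModelHom_injective (ha : ∀ j ∈ branchSet d r, IsUnit (a j))
    [IsRegularLocalRing P] (hx : ∀ i, x i ∈ maximalIdeal P)
    (hli : LinearIndependent (ResidueField P) fun i => (maximalIdeal P).toCotangent ⟨x i, hx i⟩) :
    Function.Injective (branchModelHom x r a) := by
  rw [injective_iff_map_eq_zero]
  intro c hc
  funext j
  obtain ⟨p, hp⟩ := Ideal.Quotient.mk_surjective (c j)
  have hj := j.2
  have h1 : branchToChart a j.2 (c j) = 0 := by
    rw [← branchModelHom_mul_cofactorIdem a c j, hc, zero_mul]
  rw [← hp, branchToChart_mk, cofactorIdem, ← mul_assoc,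
    IsScalarTower.algebraMap_apply P Bq (Localization.Away sbar),
    ← map_mul, Ideal.Quotient.algebraMap_eq, ← map_mul] at h1
  -- cancel the unit `1/s`
  have h2 : algebraMap Bq (Localization.Away sbar)
      (Ideal.Quotient.mk _ (p * (a j * branchCofactor x r j))) = 0 := by
    have hu : IsUnit (IsLocalization.Away.invSelf (S := Localization.Away sbar) sbar) :=
      IsUnit.of_mul_eq_one_right _ (IsLocalization.Away.mul_invSelf sbar)
    exact (hu.mul_left_eq_zero).mp h1
  have h3 : Ideal.Quotient.mk (Ideal.span {branchProd x r}) (p * (a j * branchCofactor x r j)) = 0 :=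
    algebraMap_localizationAway_injective a ha hx hli (by rw [h2, map_zero])
  rw [Ideal.Quotient.eq_zero_iff_mem] at h3
  have h4 : branchCofactor x r j * (a j * p) ∈
      Ideal.span {x j.1} := by
    have : branchCofactor x r j * (a j * p) = p * (a j * branchCofactor x r j) := by ring
    rw [this]
    exact span_branchProd_le_span_X hx hli hj h3
  have h5 := mem_span_X_of_branchCofactor_mul_mem hx hli h4
  rw [Ideal.unit_mul_mem_iff_mem _ (ha j hj)] at h5
  rw [← hp, Pi.zero_apply, Ideal.Quotient.eq_zero_iff_mem]
  exact h5

/-! ## The image is the affine blowup algebra `(P/(π))[(m_j)_j / s]` -/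

/-- `g_j` lies in the blowup algebra. [folklore] -/
theorem cofactorIdem_mem_blowupAlgebra {j : Fin d} (hj : j ∈ branchSet d r) :
    cofactorIdem x r a j ∈
      blowupAlgebra ((doubleLocusIdeal x r).map (Ideal.Quotient.mk _)) sbar :=
  div_mem_blowupAlgebra _ _ (Ideal.mem_map_of_mem _
    (Ideal.mul_mem_left _ _ (branchCofactor_mem_doubleLocusIdeal hj)))

/-- The image of `Π_j P/(xⱼ)` is contained in the blowup algebra. [folklore] -/
theorem branchModelHom_mem_blowupAlgebra (c : BranchProduct x r) :
    branchModelHom x r a c ∈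
      blowupAlgebra ((doubleLocusIdeal x r).map (Ideal.Quotient.mk _)) sbar := by
  rw [branchModelHom_apply]
  refine Subalgebra.sum_mem _ fun j _ => ?_
  obtain ⟨p, hp⟩ := Ideal.Quotient.mk_surjective (c j)
  rw [← hp, branchToChart_mk,
    IsScalarTower.algebraMap_apply P Bq (Localization.Away sbar)]
  exact Subalgebra.mul_mem _ (Subalgebra.algebraMap_mem _ _) (cofactorIdem_mem_blowupAlgebra a j.2)

/-- The range of `branchModelHom`, as a `P/(π)`-subalgebra of `(P/(π))[1/s]` (it contains the
image of `P/(π)`). [folklore] -/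
def rangeSubalgebra : Subalgebra Bq (Localization.Away sbar) where
  __ := (branchModelHom x r a).range.toSubsemiring
  algebraMap_mem' b := by
    obtain ⟨p, rfl⟩ := Ideal.Quotient.mk_surjective b
    change _ ∈ (branchModelHom x r a).range
    refine ⟨algebraMap P (BranchProduct x r) p, ?_⟩
    change branchModelHom x r a (algebraMap P (BranchProduct x r) p) = _
    rw [AlgHom.commutes]
    exact (IsScalarTower.algebraMap_apply P Bq (Localization.Away sbar) p).symm

/-- Membership in `rangeSubalgebra` is membership in the range. [folklore] -/
theorem mem_rangeSubalgebra_iff {z : Localization.Away sbar} :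
    z ∈ rangeSubalgebra a ↔ z ∈ (branchModelHom x r a).range := Iff.rfl

/-- `m_j / s = a_j⁻¹ g_j` lies in the range. [folklore] -/
theorem div_mem_range (ha : ∀ j ∈ branchSet d r, IsUnit (a j)) {j : Fin d} (hj : j ∈ branchSet d r) :
    algebraMap Bq (Localization.Away sbar) (Ideal.Quotient.mk _ (branchCofactor x r j)) *
        IsLocalization.Away.invSelf (S := Localization.Away sbar) sbar ∈
      (branchModelHom x r a).range := by
  obtain ⟨u, hu⟩ := ha j hj
  refine ⟨Pi.single ⟨j, hj⟩ (Ideal.Quotient.mk _ (↑u⁻¹ : P)), ?_⟩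
  change branchModelHom x r a (Pi.single _ _) = _
  rw [branchModelHom_single, branchToChart_mk, cofactorIdem, ← mul_assoc,
    IsScalarTower.algebraMap_apply P Bq (Localization.Away sbar),
    ← map_mul, Ideal.Quotient.algebraMap_eq, ← map_mul, ← hu, ← mul_assoc, Units.inv_mul, one_mul]

/-- **The image of `Π_j P/(xⱼ) → (P/(π))[1/s]` is the affine blowup algebra
`(P/(π))[(m_j)_j / s]`.** [folklore] -/
theorem range_branchModelHom (ha : ∀ j ∈ branchSet d r, IsUnit (a j)) :
    (branchModelHom x r a).range =
      (blowupAlgebra ((doubleLocusIdeal x r).map (Ideal.Quotient.mk _)) sbar).restrictScalars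
        P := by
  classical
  apply le_antisymm
  · rintro z ⟨c, rfl⟩
    exact branchModelHom_mem_blowupAlgebra a c
  · -- the blowup algebra is generated over `P/(π)` by the `x/s`, `x ∈ (m_j)`, all in the range
    intro y hy
    rw [Subalgebra.mem_restrictScalars] at hy
    suffices key : blowupAlgebra ((doubleLocusIdeal x r).map (Ideal.Quotient.mk _)) sbar ≤
        rangeSubalgebra (r := r) a from (mem_rangeSubalgebra_iff a).mp (key hy)
    unfold blowupAlgebra
    rw [Algebra.adjoin_le_iff]
    rintro y ⟨w, hw, rfl⟩
    change _ ∈ (branchModelHom x r a).range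
    -- write `w = Σ_j b_j m̄_j`
    rw [doubleLocusIdeal, Ideal.map_span] at hw
    have hw' : w ∈ Ideal.span (Set.range fun j : ↥(branchSet d r) =>
        Ideal.Quotient.mk (Ideal.span {branchProd x r}) (branchCofactor x r j.1)) := by
      refine Ideal.span_mono ?_ hw
      rintro _ ⟨_, ⟨j, hj, rfl⟩, rfl⟩
      exact ⟨⟨j, hj⟩, rfl⟩
    obtain ⟨b, rfl⟩ := Ideal.mem_span_range_iff_exists_fun.mp hw'
    rw [map_sum, Finset.sum_mul]
    refine Subalgebra.sum_mem _ fun j _ => ?_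
    rw [map_mul, mul_assoc]
    exact Subalgebra.mul_mem _ ((rangeSubalgebra a).algebraMap_mem (b j)) (div_mem_range a ha j.2)

variable (x r) in
/-- **The generic chart of the blow-up of the double locus is the product of the branch
rings**: `Π_{j<r} P/(xⱼ) ≃ (P/(π))[(m_j)_j / s]` as `P`-algebras, for
`s = Σ_j a_j m_j` with unit coefficients `a_j`. [folklore] -/
def branchModelEquiv (ha : ∀ j ∈ branchSet d r, IsUnit (a j))
    [IsRegularLocalRing P] (hx : ∀ i, x i ∈ maximalIdeal P)
    (hli : LinearIndependent (ResidueField P) fun i => (maximalIdeal P).toCotangent ⟨x i, hx i⟩) :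
    BranchProduct x r ≃ₐ[P]
      ↥((blowupAlgebra ((doubleLocusIdeal x r).map (Ideal.Quotient.mk _)) sbar).restrictScalars
        P) :=
  (AlgEquiv.ofInjective (branchModelHom x r a) (branchModelHom_injective a ha hx hli)).trans
    (Subalgebra.equivOfEq _ _ (range_branchModelHom a ha))

/-- Unfolding `branchModelEquiv`. [folklore] -/
theorem branchModelEquiv_apply (ha : ∀ j ∈ branchSet d r, IsUnit (a j))
    [IsRegularLocalRing P] (hx : ∀ i, x i ∈ maximalIdeal P)
    (hli : LinearIndependent (ResidueField P) fun i => (maximalIdeal P).toCotangent ⟨x i, hx i⟩)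
    (c : BranchProduct x r) :
    (branchModelEquiv x r a ha hx hli c : Localization.Away sbar) = branchModelHom x r a c := rfl

end Chart

/-! ## The power series instance -/

section PowerSeries

variable (k : Type u) [Field k] (d)

/-- The variables of `k⟦X₁, …, X_d⟧` have linearly independent images in `𝔪/𝔪²`. [folklore] -/
theorem linearIndependent_toCotangent_X :
    haveI := isRegularLocalRing_mvPowerSeries k (Fin d)
    LinearIndependent (ResidueField (MvPowerSeries (Fin d) k)) fun i : Fin d =>
      (maximalIdeal (MvPowerSeries (Fin d) k)).toCotangent
        ⟨MvPowerSeries.X i, X_mem_maximalIdeal k (Fin d) i⟩ := by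
  haveI := isRegularLocalRing_mvPowerSeries k (Fin d)
  have hdim : ringKrullDim (MvPowerSeries (Fin d) k) = (d : ℕ) := by
    rw [ringKrullDim_mvPowerSeries, Nat.card_eq_fintype_card, Fintype.card_fin]
  exact linearIndependent_toCotangent_of_span_eq_maximalIdeal hdim
    (MvPowerSeries.X : Fin d → MvPowerSeries (Fin d) k)
    (maximalIdeal_mvPowerSeries_eq_span k (Fin d)).symm

end PowerSeries

end Literature.AlgebraicGeometry.Resolution

end
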